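import Mathlib
import HarnessLib
import Summits.NavierStokesRegularity.NavierStokesRegularity.Theorems.PoloidalWindowDoorPoloidalWindowRigidityThmARelocation
import Summits.NavierStokesRegularity.NavierStokesRegularity.Theorems.PoloidalWindowDoorPoloidalWindowRigidityDegenerateSlice

/-!
# Route `PoloidalWindowDoor`, item `LrcModEntire` (stmt-NavierStokesRegularity-20428) / crux K2 (stmt-19708) —
# the POINT PENTACHOTOMY of a poloidal class profile (stub S2 `stub_threadDichotomy` of the ideator LINES `far_thread` / `thread_axis`, VERBATIM)

LEAD of item 20428 ns-poloidal-K2-p3 g10 (`--supports stmt-NavierStokesRegularity-20428 --as helper`).  Pure point-set topology on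
the backward slab from the joint continuity of the Jacobian entries (`…K2OfLrcSlope.continuousOn_fderiv_entry`), of the twist bracket
(`…ThmARelocation.continuousOn_twist`) and of the vorticity, plus the open-splitting lemma `…DegenerateSlice.forall_or_exists_open_of_pointwise_or`.
For a poloidal class profile and a point `z₀` of the slab, ONE of: (i) a THICK, non-degenerate, TWISTING open set accumulating at `z₀`;
(ii) a non-degenerate UNTWISTED window; (iii) a non-degenerate, pinned, twisting (TH) window; (iv) a window with TIME-ONLY slope; (v) an
open DEGENERATE germ on one slice.  Proof: `O := slab ∩ {ND ∧ T ≠ 0}` is open; if `z₀ ∈ closure O`, (i) with `W = O` unless thickness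
fails on a sub-window (⇒ (iii), or (iv) if its pin fails); else a ball about `z₀` misses `O`: a non-degenerate point in it gives (ii),
otherwise the pointwise degenerate disjunction on the `z₀.1`-slice of the ball splits into (v).
With `…ExtremalThread.extremalThread` (S1, p629364) and `…ThreadPins` (S5) this leaves the ideator lines' THICK column with exactly
ONE research statement (far_thread S3 / thread_axis S3′+S6G) besides the shared (TH) stub.

WHAT THIS IS NOT: not a claim about Navier–Stokes regularity and not the thick stub — a case split (bears_on LADDER-NS N0). [folklore]
-/

noncomputable section

-- the summit and its single sub-problem share the name (CONVENTIONS §1), as in every Theorems file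
set_option linter.dupNamespace false

namespace Summit.NavierStokesRegularity.NavierStokesRegularity.Theorems.PoloidalWindowDoorLrcModEntireThreadDichotomy

open MeasureTheory Set Function Filter Topology Metric
open scoped RealInnerProductSpace InnerProductSpace
open Literature.Analysis Literature.Analysis.FluidPDE
open Summit.NavierStokesRegularity.NavierStokesRegularity.Theorems
open Summit.NavierStokesRegularity.NavierStokesRegularity.Theorems.PoloidalWindowDoorPoloidalWindowRigidityK2OfLrcSlope
open Summit.NavierStokesRegularity.NavierStokesRegularity.Theorems.PoloidalWindowDoorPoloidalWindowRigidityThmARelocation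
open Summit.NavierStokesRegularity.NavierStokesRegularity.Theorems.PoloidalWindowDoorPoloidalWindowRigidityDegenerateSlice
open Summit.NavierStokesRegularity.NavierStokesRegularity.Theorems.PoloidalWindowDoorPoloidalWindowRigidityWindow

/-- An open-set version of «`f ≠ 0` is open»: for `f` continuous on an open set `S`, `S ∩ {f ≠ 0}` is open. [folklore] -/
theorem isOpen_inter_ne {X Y : Type*} [TopologicalSpace X] [TopologicalSpace Y] [T1Space Y] {S : Set X} {f : X → Y}
    (hS : IsOpen S) (hf : ContinuousOn f S) (c : Y) : IsOpen (S ∩ {x | f x ≠ c}) := by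
  have : S ∩ {x | f x ≠ c} = S ∩ f ⁻¹' {c}ᶜ := rfl
  rw [this]
  exact hf.isOpen_inter_preimage hS isOpen_compl_singleton

/-- **POINT PENTACHOTOMY** (= stub S2 `stub_threadDichotomy` of `Cruxes/PoloidalWindowRigidity/Lines/far_thread.lean` / `thread_axis.lean`,
VERBATIM). [folklore] -/
theorem threadDichotomy :
    ∀ (C : ℝ) (v : ℝ → EuclideanSpace ℝ (Fin 3) → EuclideanSpace ℝ (Fin 3)),
      Literature.Analysis.FluidPDE.HasTypeITimeDecay C v →
      ContinuousOn (Function.uncurry v) (Set.Iio (0 : ℝ) ×ˢ Set.univ) →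
      (∀ s t : ℝ, s < t → t < 0 → ∀ x, v t x =
        Literature.Analysis.UnboundedOperators.heatExtension (v s) (t - s) x -
          Literature.Analysis.FluidPDE.oseenDuhamel 1 s v v t x) →
      (∀ t < 0, Literature.Analysis.FluidPDE.VectorCalculus.IsDivFree (v t)) →
      (∀ s < 0, ∀ y, ⟪Literature.Analysis.FluidPDE.curl (v s) y, EuclideanSpace.single 2 1⟫_ℝ = 0) →
      ∀ z₀ : ℝ × EuclideanSpace ℝ (Fin 3), z₀.1 < 0 →
        (∃ W : Set (ℝ × EuclideanSpace ℝ (Fin 3)), IsOpen W ∧ W ⊆ Set.Iio (0 : ℝ) ×ˢ Set.univ ∧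
          (∀ z ∈ W, (Literature.Analysis.FluidPDE.curl (v z.1) z.2 ≠ 0 ∧
            (fderiv ℝ (v z.1) z.2 (EuclideanSpace.single 0 1) 2 ≠ 0 ∨ fderiv ℝ (v z.1) z.2 (EuclideanSpace.single 1 1) 2 ≠ 0) ∧
            (fderiv ℝ (v z.1) z.2 (EuclideanSpace.single 2 1) 0 ≠ 0 ∨ fderiv ℝ (v z.1) z.2 (EuclideanSpace.single 2 1) 1 ≠ 0)) ∧
            (fderiv ℝ (fun x => fderiv ℝ (v z.1) x (EuclideanSpace.single 2 1) 2) z.2 (EuclideanSpace.single 0 1) *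
                fderiv ℝ (v z.1) z.2 (EuclideanSpace.single 1 1) 2 -
              fderiv ℝ (fun x => fderiv ℝ (v z.1) x (EuclideanSpace.single 2 1) 2) z.2 (EuclideanSpace.single 1 1) *
                fderiv ℝ (v z.1) z.2 (EuclideanSpace.single 0 1) 2 ≠ 0)) ∧
          (∀ m : ℝ → ℝ → ℝ, ∀ W₁ : Set (ℝ × EuclideanSpace ℝ (Fin 3)), W₁ ⊆ W → IsOpen W₁ → W₁.Nonempty →
            ∃ z ∈ W₁, ∃ b : Fin 3, b ≠ 2 ∧
              fderiv ℝ (v z.1) z.2 (EuclideanSpace.single 2 1) b ≠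
                m z.1 (z.2 2) * fderiv ℝ (v z.1) z.2 (EuclideanSpace.single b 1) 2) ∧
          (∀ r : ℝ, 0 < r → (Metric.ball z₀ r ∩ W).Nonempty)) ∨
        (∃ W : Set (ℝ × EuclideanSpace ℝ (Fin 3)), IsOpen W ∧ W.Nonempty ∧ W ⊆ Set.Iio (0 : ℝ) ×ˢ Set.univ ∧
          (∀ z ∈ W, (Literature.Analysis.FluidPDE.curl (v z.1) z.2 ≠ 0 ∧
            (fderiv ℝ (v z.1) z.2 (EuclideanSpace.single 0 1) 2 ≠ 0 ∨ fderiv ℝ (v z.1) z.2 (EuclideanSpace.single 1 1) 2 ≠ 0) ∧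
            (fderiv ℝ (v z.1) z.2 (EuclideanSpace.single 2 1) 0 ≠ 0 ∨ fderiv ℝ (v z.1) z.2 (EuclideanSpace.single 2 1) 1 ≠ 0))) ∧
          (∀ z ∈ W, (fderiv ℝ (fun x => fderiv ℝ (v z.1) x (EuclideanSpace.single 2 1) 2) z.2 (EuclideanSpace.single 0 1) *
                fderiv ℝ (v z.1) z.2 (EuclideanSpace.single 1 1) 2 -
              fderiv ℝ (fun x => fderiv ℝ (v z.1) x (EuclideanSpace.single 2 1) 2) z.2 (EuclideanSpace.single 1 1) *
                fderiv ℝ (v z.1) z.2 (EuclideanSpace.single 0 1) 2 = 0))) ∨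
        (∃ W : Set (ℝ × EuclideanSpace ℝ (Fin 3)), IsOpen W ∧ W.Nonempty ∧ W ⊆ Set.Iio (0 : ℝ) ×ˢ Set.univ ∧
          (∀ z ∈ W, (Literature.Analysis.FluidPDE.curl (v z.1) z.2 ≠ 0 ∧
            (fderiv ℝ (v z.1) z.2 (EuclideanSpace.single 0 1) 2 ≠ 0 ∨ fderiv ℝ (v z.1) z.2 (EuclideanSpace.single 1 1) 2 ≠ 0) ∧
            (fderiv ℝ (v z.1) z.2 (EuclideanSpace.single 2 1) 0 ≠ 0 ∨ fderiv ℝ (v z.1) z.2 (EuclideanSpace.single 2 1) 1 ≠ 0))) ∧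
          (∀ m : ℝ → ℝ, ∀ W₁ : Set (ℝ × EuclideanSpace ℝ (Fin 3)), W₁ ⊆ W → IsOpen W₁ → W₁.Nonempty →
            ∃ z ∈ W₁, ∃ b : Fin 3, b ≠ 2 ∧
              fderiv ℝ (v z.1) z.2 (EuclideanSpace.single 2 1) b ≠
                m z.1 * fderiv ℝ (v z.1) z.2 (EuclideanSpace.single b 1) 2) ∧
          (∀ z ∈ W, (fderiv ℝ (fun x => fderiv ℝ (v z.1) x (EuclideanSpace.single 2 1) 2) z.2 (EuclideanSpace.single 0 1) *
                fderiv ℝ (v z.1) z.2 (EuclideanSpace.single 1 1) 2 -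
              fderiv ℝ (fun x => fderiv ℝ (v z.1) x (EuclideanSpace.single 2 1) 2) z.2 (EuclideanSpace.single 1 1) *
                fderiv ℝ (v z.1) z.2 (EuclideanSpace.single 0 1) 2 ≠ 0)) ∧
          (∃ m : ℝ → ℝ → ℝ, ∀ z ∈ W, ∀ b : Fin 3, b ≠ 2 →
            fderiv ℝ (v z.1) z.2 (EuclideanSpace.single 2 1) b =
              m z.1 (z.2 2) * fderiv ℝ (v z.1) z.2 (EuclideanSpace.single b 1) 2)) ∨
        (∃ W : Set (ℝ × EuclideanSpace ℝ (Fin 3)), IsOpen W ∧ W.Nonempty ∧ W ⊆ Set.Iio (0 : ℝ) ×ˢ Set.univ ∧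
          (∃ m : ℝ → ℝ, ∀ z ∈ W, ∀ b : Fin 3, b ≠ 2 →
            fderiv ℝ (v z.1) z.2 (EuclideanSpace.single 2 1) b =
              m z.1 * fderiv ℝ (v z.1) z.2 (EuclideanSpace.single b 1) 2)) ∨
        (∃ s : ℝ, s < 0 ∧ ∃ U : Set (EuclideanSpace ℝ (Fin 3)), IsOpen U ∧ U.Nonempty ∧
          ((∀ y ∈ U, Literature.Analysis.FluidPDE.curl (v s) y = 0) ∨
           (∀ y ∈ U, fderiv ℝ (v s) y (EuclideanSpace.single 0 1) 2 = 0 ∧ fderiv ℝ (v s) y (EuclideanSpace.single 1 1) 2 = 0) ∨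
           (∀ y ∈ U, fderiv ℝ (v s) y (EuclideanSpace.single 2 1) 0 = 0 ∧ fderiv ℝ (v s) y (EuclideanSpace.single 2 1) 1 = 0))) := by
  intro C v hrate hcont hmild hdiv hpol z₀ hz₀
  -- ## notation
  set slab : Set (ℝ × EuclideanSpace ℝ (Fin 3)) := Set.Iio (0 : ℝ) ×ˢ Set.univ with hslab_def
  have hslab : IsOpen slab := isOpen_Iio.prod isOpen_univ
  set D : ℝ × EuclideanSpace ℝ (Fin 3) → Fin 3 → Fin 3 → ℝ := fun z j i =>
    fderiv ℝ (v z.1) z.2 (EuclideanSpace.single j 1) i with hD_def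
  set T : ℝ × EuclideanSpace ℝ (Fin 3) → ℝ := fun z =>
    fderiv ℝ (fun x => fderiv ℝ (v z.1) x (EuclideanSpace.single 2 1) 2) z.2 (EuclideanSpace.single 0 1) *
        fderiv ℝ (v z.1) z.2 (EuclideanSpace.single 1 1) 2 -
      fderiv ℝ (fun x => fderiv ℝ (v z.1) x (EuclideanSpace.single 2 1) 2) z.2 (EuclideanSpace.single 1 1) *
        fderiv ℝ (v z.1) z.2 (EuclideanSpace.single 0 1) 2 with hT_def
  set K : ℝ × EuclideanSpace ℝ (Fin 3) → EuclideanSpace ℝ (Fin 3) := fun z => curl (v z.1) z.2 with hK_def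
  -- ## continuity on the slab
  have hv : IsTypeIAncientMild C v := isTypeIAncientMild_of_class hrate hcont hmild hdiv
  have hDc : ∀ j i, ContinuousOn (fun z => D z j i) slab := fun j i => continuousOn_fderiv_entry hrate hcont hmild j i
  have hTc : ContinuousOn T slab := continuousOn_twist hrate hcont hmild
  have hFc : ContinuousOn (fun z : ℝ × EuclideanSpace ℝ (Fin 3) => fderiv ℝ (v z.1) z.2) slab :=
    IsSmoothSpaceTimeOn.continuousOn_fderiv_slice (S := Set.Iio 0) (w := v) hv.contDiffOn isOpen_Iio.uniqueDiffOn
  have hKc : ContinuousOn K slab := by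
    have e : K = fun z => curlCLM (fderiv ℝ (v z.1) z.2) := funext fun z => curl_eq_curlCLM _ _
    rw [e]
    exact curlCLM.continuous.comp_continuousOn hFc
  -- ## the open set of non-degenerate twisting points
  set A : Set (ℝ × EuclideanSpace ℝ (Fin 3)) := slab ∩ {z | K z ≠ 0} with hA_def
  set B : Set (ℝ × EuclideanSpace ℝ (Fin 3)) := (slab ∩ {z | D z 0 2 ≠ 0}) ∪ (slab ∩ {z | D z 1 2 ≠ 0}) with hB_def
  set B' : Set (ℝ × EuclideanSpace ℝ (Fin 3)) := (slab ∩ {z | D z 2 0 ≠ 0}) ∪ (slab ∩ {z | D z 2 1 ≠ 0}) with hB'_def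
  set E : Set (ℝ × EuclideanSpace ℝ (Fin 3)) := slab ∩ {z | T z ≠ 0} with hE_def
  have hAo : IsOpen A := isOpen_inter_ne hslab hKc 0
  have hBo : IsOpen B := (isOpen_inter_ne hslab (hDc 0 2) 0).union (isOpen_inter_ne hslab (hDc 1 2) 0)
  have hB'o : IsOpen B' := (isOpen_inter_ne hslab (hDc 2 0) 0).union (isOpen_inter_ne hslab (hDc 2 1) 0)
  have hEo : IsOpen E := isOpen_inter_ne hslab hTc 0
  set N : Set (ℝ × EuclideanSpace ℝ (Fin 3)) := A ∩ B ∩ B' with hN_def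
  have hNo : IsOpen N := (hAo.inter hBo).inter hB'o
  have hNslab : N ⊆ slab := fun z hz => hz.1.1.1
  -- membership in `N` is non-degeneracy
  have hND_of_mem : ∀ z ∈ N, curl (v z.1) z.2 ≠ 0 ∧
      (fderiv ℝ (v z.1) z.2 (EuclideanSpace.single 0 1) 2 ≠ 0 ∨ fderiv ℝ (v z.1) z.2 (EuclideanSpace.single 1 1) 2 ≠ 0) ∧
      (fderiv ℝ (v z.1) z.2 (EuclideanSpace.single 2 1) 0 ≠ 0 ∨ fderiv ℝ (v z.1) z.2 (EuclideanSpace.single 2 1) 1 ≠ 0) := by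
    rintro z ⟨⟨hzA, hzB⟩, hzB'⟩
    refine ⟨hzA.2, ?_, ?_⟩
    · rcases hzB with h | h
      · exact Or.inl h.2
      · exact Or.inr h.2
    · rcases hzB' with h | h
      · exact Or.inl h.2
      · exact Or.inr h.2
  have hmem_of_ND : ∀ z ∈ slab, (curl (v z.1) z.2 ≠ 0 ∧
      (fderiv ℝ (v z.1) z.2 (EuclideanSpace.single 0 1) 2 ≠ 0 ∨ fderiv ℝ (v z.1) z.2 (EuclideanSpace.single 1 1) 2 ≠ 0) ∧
      (fderiv ℝ (v z.1) z.2 (EuclideanSpace.single 2 1) 0 ≠ 0 ∨ fderiv ℝ (v z.1) z.2 (EuclideanSpace.single 2 1) 1 ≠ 0)) → z ∈ N := by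
    rintro z hz ⟨h1, h2, h3⟩
    refine ⟨⟨⟨hz, h1⟩, ?_⟩, ?_⟩
    · rcases h2 with h | h
      · exact Or.inl ⟨hz, h⟩
      · exact Or.inr ⟨hz, h⟩
    · rcases h3 with h | h
      · exact Or.inl ⟨hz, h⟩
      · exact Or.inr ⟨hz, h⟩
  set O : Set (ℝ × EuclideanSpace ℝ (Fin 3)) := N ∩ E with hO_def
  have hOo : IsOpen O := hNo.inter hEo
  have hOslab : O ⊆ slab := fun z hz => hNslab hz.1
  -- ## Case A: the twisting non-degenerate set accumulates at z₀
  by_cases hacc : ∀ r : ℝ, 0 < r → (Metric.ball z₀ r ∩ O).Nonempty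
  · by_cases hthick : ∀ m : ℝ → ℝ → ℝ, ∀ W₁ : Set (ℝ × EuclideanSpace ℝ (Fin 3)), W₁ ⊆ O → IsOpen W₁ → W₁.Nonempty →
        ∃ z ∈ W₁, ∃ b : Fin 3, b ≠ 2 ∧
          fderiv ℝ (v z.1) z.2 (EuclideanSpace.single 2 1) b ≠
            m z.1 (z.2 2) * fderiv ℝ (v z.1) z.2 (EuclideanSpace.single b 1) 2
    · -- (i): W = O
      refine Or.inl ⟨O, hOo, hOslab, fun z hz => ⟨hND_of_mem z hz.1, hz.2.2⟩, hthick, hacc⟩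
    · push Not at hthick
      obtain ⟨m, W₁, hW₁O, hW₁o, hW₁ne, hTH⟩ := hthick
      by_cases hpin : ∀ m' : ℝ → ℝ, ∀ W₂ : Set (ℝ × EuclideanSpace ℝ (Fin 3)), W₂ ⊆ W₁ → IsOpen W₂ → W₂.Nonempty →
          ∃ z ∈ W₂, ∃ b : Fin 3, b ≠ 2 ∧
            fderiv ℝ (v z.1) z.2 (EuclideanSpace.single 2 1) b ≠
              m' z.1 * fderiv ℝ (v z.1) z.2 (EuclideanSpace.single b 1) 2
      · -- (iii): W = W₁ is a pinned twisting (TH) window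
        refine Or.inr (Or.inr (Or.inl ⟨W₁, hW₁o, hW₁ne, hW₁O.trans hOslab, fun z hz => hND_of_mem z (hW₁O hz).1, hpin,
          fun z hz => (hW₁O hz).2.2, ⟨m, fun z hz b hb => hTH z hz b hb⟩⟩))
      · -- (iv): a time-only slope window
        push Not at hpin
        obtain ⟨m', W₂, hW₂W₁, hW₂o, hW₂ne, hTV⟩ := hpin
        exact Or.inr (Or.inr (Or.inr (Or.inl ⟨W₂, hW₂o, hW₂ne, (hW₂W₁.trans hW₁O).trans hOslab,
          ⟨m', fun z hz b hb => hTV z hz b hb⟩⟩)))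
  -- ## Case B: a ball about z₀ misses O
  · push Not at hacc
    obtain ⟨r, hr, hempty⟩ := hacc
    have hmiss : ∀ z ∈ Metric.ball z₀ r, z ∉ O := by
      intro z hz hzO
      have hzz : z ∈ Metric.ball z₀ r ∩ O := ⟨hz, hzO⟩
      rw [hempty] at hzz
      exact hzz
    set Bz : Set (ℝ × EuclideanSpace ℝ (Fin 3)) := Metric.ball z₀ r ∩ slab with hBz_def
    have hBzo : IsOpen Bz := Metric.isOpen_ball.inter hslab
    have hz₀slab : z₀ ∈ slab := mk_mem_prod (mem_Iio.2 hz₀) (mem_univ _)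
    have hz₀Bz : z₀ ∈ Bz := ⟨Metric.mem_ball_self hr, hz₀slab⟩
    by_cases hndpt : ∃ z ∈ Bz, curl (v z.1) z.2 ≠ 0 ∧
        (fderiv ℝ (v z.1) z.2 (EuclideanSpace.single 0 1) 2 ≠ 0 ∨ fderiv ℝ (v z.1) z.2 (EuclideanSpace.single 1 1) 2 ≠ 0) ∧
        (fderiv ℝ (v z.1) z.2 (EuclideanSpace.single 2 1) 0 ≠ 0 ∨ fderiv ℝ (v z.1) z.2 (EuclideanSpace.single 2 1) 1 ≠ 0)
    · -- (ii): an untwisted non-degenerate window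
      obtain ⟨z₁, hz₁Bz, hz₁ND⟩ := hndpt
      set W : Set (ℝ × EuclideanSpace ℝ (Fin 3)) := Bz ∩ N with hW_def
      have hWo : IsOpen W := hBzo.inter hNo
      have hWne : W.Nonempty := ⟨z₁, hz₁Bz, hmem_of_ND z₁ hz₁Bz.2 hz₁ND⟩
      refine Or.inr (Or.inl ⟨W, hWo, hWne, fun z hz => hz.1.2, fun z hz => hND_of_mem z hz.2, fun z hz => ?_⟩)
      by_contra hT
      exact hmiss z hz.1.1 ⟨hz.2, ⟨hz.1.2, hT⟩⟩
    · -- (v): the `z₀.1`-slice of the ball is pointwise degenerate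
      push Not at hndpt
      set s : ℝ := z₀.1 with hs_def
      have hs : s < 0 := hz₀
      set V : Set (EuclideanSpace ℝ (Fin 3)) := {y | (s, y) ∈ Metric.ball z₀ r} with hV_def
      have hVo : IsOpen V := Metric.isOpen_ball.preimage (Continuous.prodMk_right s)
      have hVne : V.Nonempty := ⟨z₀.2, by
        show (s, z₀.2) ∈ Metric.ball z₀ r
        rw [hs_def, Prod.mk.eta]; exact Metric.mem_ball_self hr⟩
      -- the degenerate trichotomy at every point of the slice
      have hdeg : ∀ y ∈ V, curl (v s) y = 0 ∨
          ((fderiv ℝ (v s) y (EuclideanSpace.single 0 1) 2 = 0 ∧ fderiv ℝ (v s) y (EuclideanSpace.single 1 1) 2 = 0) ∨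
           (fderiv ℝ (v s) y (EuclideanSpace.single 2 1) 0 = 0 ∧ fderiv ℝ (v s) y (EuclideanSpace.single 2 1) 1 = 0)) := by
        intro y hy
        have hzB : ((s, y) : ℝ × EuclideanSpace ℝ (Fin 3)) ∈ Bz := ⟨hy, mk_mem_prod (mem_Iio.2 hs) (mem_univ _)⟩
        have h := hndpt (s, y) hzB
        by_cases h1 : curl (v s) y = 0
        · exact Or.inl h1
        · right
          have h' := h h1
          by_cases h2 : fderiv ℝ (v s) y (EuclideanSpace.single 0 1) 2 = 0 ∧ fderiv ℝ (v s) y (EuclideanSpace.single 1 1) 2 = 0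
          · exact Or.inl h2
          · right
            have h2' : fderiv ℝ (v s) y (EuclideanSpace.single 0 1) 2 ≠ 0 ∨ fderiv ℝ (v s) y (EuclideanSpace.single 1 1) 2 ≠ 0 := by
              by_contra hh; push Not at hh; exact h2 hh
            exact h' h2'
      -- continuity on the slice
      have hcd : ContDiff ℝ ((⊤ : ℕ∞) : WithTop ℕ∞) (v s) := hv.contDiff_slice hs
      have hfdc : Continuous (fderiv ℝ (v s)) := hcd.continuous_fderiv (by simp)
      have hentc : ∀ j i : Fin 3, Continuous fun y => fderiv ℝ (v s) y (EuclideanSpace.single j 1) i := fun j i =>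
        (EuclideanSpace.proj i).continuous.comp
          (((ContinuousLinearMap.apply ℝ (EuclideanSpace ℝ (Fin 3)) (EuclideanSpace.single j (1 : ℝ))).continuous).comp hfdc)
      have hcurlc : Continuous (curl (v s)) := by
        have e : curl (v s) = fun y => curlCLM (fderiv ℝ (v s) y) := funext fun y => curl_eq_curlCLM _ _
        rw [e]; exact curlCLM.continuous.comp hfdc
      have hP1 : IsClosed {y : EuclideanSpace ℝ (Fin 3) | curl (v s) y = 0} := isClosed_eq hcurlc continuous_const
      have hP2 : IsClosed {y : EuclideanSpace ℝ (Fin 3) |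
          fderiv ℝ (v s) y (EuclideanSpace.single 0 1) 2 = 0 ∧ fderiv ℝ (v s) y (EuclideanSpace.single 1 1) 2 = 0} :=
        (isClosed_eq (hentc 0 2) continuous_const).inter (isClosed_eq (hentc 1 2) continuous_const)
      -- first split: everywhere irrotational on `V`, or an open piece where the slope alternatives hold
      rcases forall_or_exists_open_of_pointwise_or hVo hP1 hdeg with hall | ⟨W, hWo, hWne, hWV, hW⟩
      · exact Or.inr (Or.inr (Or.inr (Or.inr ⟨s, hs, V, hVo, hVne, Or.inl hall⟩)))
      · rcases forall_or_exists_open_of_pointwise_or hWo hP2 hW with hall2 | ⟨W', hW'o, hW'ne, hW'W, hW'⟩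
        · exact Or.inr (Or.inr (Or.inr (Or.inr ⟨s, hs, W, hWo, hWne, Or.inr (Or.inl hall2)⟩)))
        · exact Or.inr (Or.inr (Or.inr (Or.inr ⟨s, hs, W', hW'o, hW'ne, Or.inr (Or.inr hW')⟩)))

end Summit.NavierStokesRegularity.NavierStokesRegularity.Theorems.PoloidalWindowDoorLrcModEntireThreadDichotomy
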